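import Summits.CriticalPhenomena.PercolationContinuityZ3.Theorems.PercNearOneGluingNoHeavyLowerTailFrontierDecRowsEdgeInduction
import HarnessLib

/-!
# Sahi's cubic along TWO edges: the tensor-Bernstein ("root-fibre") expansion and its schema

Support file for the Sahi programme (`--supports stmt-CriticalPhenomena-4575`, prover prim-sahi-p2 gen 29).  No named facts, no sorries;
standard axioms.  Memo `run/shared/lean/prim/prim-sahi/FROM-prim-sahi-p2-gen29-ROOT-FIBRE-DICHOTOMY.md`, `prim-sahi-p2/PROOF-E3.md` §39.

`EdgeInduction.sahiE3_oneBond` expands Sahi's cubic `E₃(A,B,C)` under `prodBernoulli w` in the weight `p = w e` of ONE pair as a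
Bernstein cubic whose mixed coefficients are the polarised forms `polar₁`.  Here we expand in the weights `p = w e₁`, `r = w e₂` of TWO
distinct pairs at once.  Realise `E₃` as an expectation over three independent copies of the configuration and condition each copy on the
states of `e₁, e₂`: copy `m` sees the PINNED law `P^{ab} = prodBernoulli w[e₁ ↦ a][e₂ ↦ b]` (`a, b ∈ {0,1}`), and by trilinearity

  `E₃(P_w) = Σ_{i,j=0}^{3} p^i (1−p)^{3−i} r^j (1−r)^{3−j} · RF_{ij}`,

where the ROOT-FIBRE SUM `RF_{ij}` is the sum, over the ordered assignments of states to the three copies in which exactly `i` copies have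
`e₁` open and exactly `j` copies have `e₂` open, of the symmetric trilinear polarisation `trilin` of `E₃` evaluated at the three pinned laws
(`sahiE3_twoBond`).  Twelve of the sixteen `RF_{ij}` are one-edge data of pinned laws — the four corner cubics `E₃(P^{ab})` and eight
polarised forms `polar₁` along one pair with the other pair pinned —; the remaining four, `RF₁₁, RF₁₂, RF₂₁, RF₂₂`, are genuinely
two-edge ("mixed root fibres", `twoEdgeRF11` … `twoEdgeRF22`).  **Schema** (`sahiE3_nonneg_of_twoBond`): if all sixteen are nonnegative
then `E₃(P_w)(A,B,C) ≥ 0`.  Everything here holds for ARBITRARY events `A, B, C`; for the increasing star at a root of degree two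
(`e₁ = s(s,u)`, `e₂ = s(s,v)`) the corner/`polar₁` hypotheses are induction hypotheses and root-edge Bernstein (hRZ) forms of the pinned
graphs, `RF₁₁ ≥ 0` follows from Harris' inequality, and `RF₁₂, RF₂₁ ≥ 0` hold by exact certificates in the port/target algebra (memo §2–§3);
nothing in this file asserts those facts.
-/

noncomputable section

namespace Summit.CriticalPhenomena.PercolationContinuityZ3.Theorems

namespace EdgeInduction

open MeasureTheory Literature.Probability.Percolation Literature.Probability.LatticeModels
open scoped Classical

variable {n : ℕ}

/-- The symmetric trilinear polarisation of Sahi's cubic: `6·trilin(μ₁,μ₂,μ₃) = 4Σ_m μ_m(ABC) + Σ_σ μ_σ1(A)μ_σ2(B)μ_σ3(C)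
− Σ_{slots} Σ_{m≠m'} μ_m(single)μ_{m'}(pair)`; `trilin μ μ μ = E₃(μ)` (`trilin_self`) and `trilin ν μ μ = polar₁ μ ν` (`trilin_polar₁`).
[this work] -/
def trilin (μ₁ μ₂ μ₃ : Measure (BondConfig (Fin n))) (A B C : Set (BondConfig (Fin n))) : ℝ :=
  (1 / 6 : ℝ) *
    (4 * (μ₁.real (A ∩ B ∩ C) + μ₂.real (A ∩ B ∩ C) + μ₃.real (A ∩ B ∩ C))
      + (μ₁.real A * μ₂.real B * μ₃.real C + μ₁.real A * μ₃.real B * μ₂.real C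
          + μ₂.real A * μ₁.real B * μ₃.real C + μ₂.real A * μ₃.real B * μ₁.real C
          + μ₃.real A * μ₁.real B * μ₂.real C + μ₃.real A * μ₂.real B * μ₁.real C)
      - (μ₁.real A * (μ₂.real (B ∩ C) + μ₃.real (B ∩ C)) + μ₂.real A * (μ₁.real (B ∩ C) + μ₃.real (B ∩ C))
          + μ₃.real A * (μ₁.real (B ∩ C) + μ₂.real (B ∩ C))
          + μ₁.real B * (μ₂.real (A ∩ C) + μ₃.real (A ∩ C)) + μ₂.real B * (μ₁.real (A ∩ C) + μ₃.real (A ∩ C))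
          + μ₃.real B * (μ₁.real (A ∩ C) + μ₂.real (A ∩ C))
          + μ₁.real C * (μ₂.real (A ∩ B) + μ₃.real (A ∩ B)) + μ₂.real C * (μ₁.real (A ∩ B) + μ₃.real (A ∩ B))
          + μ₃.real C * (μ₁.real (A ∩ B) + μ₂.real (A ∩ B))))

/-- On the diagonal the polarisation is Sahi's cubic: `trilin μ μ μ = E₃(μ)`. [this work] -/
theorem trilin_self (μ : Measure (BondConfig (Fin n))) (A B C : Set (BondConfig (Fin n))) :
    trilin μ μ μ A B C = sahiE3 μ A B C := by
  simp only [trilin, sahiE3]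
  ring

/-- With two equal arguments the polarisation is the one-edge mixed Bernstein form: `trilin ν μ μ = polar₁ μ ν`. [this work] -/
theorem trilin_polar₁ (μ ν : Measure (BondConfig (Fin n))) (A B C : Set (BondConfig (Fin n))) :
    trilin ν μ μ A B C = polar₁ μ ν A B C := by
  simp only [trilin, polar₁]
  ring

/-- `trilin` is symmetric under exchanging its first two arguments. [this work] -/
theorem trilin_comm₁₂ (μ₁ μ₂ μ₃ : Measure (BondConfig (Fin n))) (A B C : Set (BondConfig (Fin n))) :
    trilin μ₁ μ₂ μ₃ A B C = trilin μ₂ μ₁ μ₃ A B C := by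
  simp only [trilin]
  ring

/-- `trilin` is symmetric under exchanging its last two arguments. [this work] -/
theorem trilin_comm₂₃ (μ₁ μ₂ μ₃ : Measure (BondConfig (Fin n))) (A B C : Set (BondConfig (Fin n))) :
    trilin μ₁ μ₂ μ₃ A B C = trilin μ₁ μ₃ μ₂ A B C := by
  simp only [trilin]
  ring

/-- The law pinned at two pairs: `pin₂ w e₁ e₂ a b = prodBernoulli w[e₁ ↦ a][e₂ ↦ b]`. [this work] -/
def pin₂ (w : Sym2 (Fin n) → unitInterval) (e₁ e₂ : Sym2 (Fin n)) (a b : unitInterval) : Measure (BondConfig (Fin n)) :=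
  prodBernoulli (Function.update (Function.update w e₁ a) e₂ b)

/-- The mixed root fibre of profile `(1,1)`: `3·trilin(P¹¹,P⁰⁰,P⁰⁰) + 6·trilin(P¹⁰,P⁰¹,P⁰⁰)`. [this work] -/
def twoEdgeRF11 (w : Sym2 (Fin n) → unitInterval) (e₁ e₂ : Sym2 (Fin n)) (A B C : Set (BondConfig (Fin n))) : ℝ :=
  3 * trilin (pin₂ w e₁ e₂ 1 1) (pin₂ w e₁ e₂ 0 0) (pin₂ w e₁ e₂ 0 0) A B C
    + 6 * trilin (pin₂ w e₁ e₂ 1 0) (pin₂ w e₁ e₂ 0 1) (pin₂ w e₁ e₂ 0 0) A B C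

/-- The mixed root fibre of profile `(1,2)`: `3·trilin(P¹⁰,P⁰¹,P⁰¹) + 6·trilin(P¹¹,P⁰¹,P⁰⁰)`. [this work] -/
def twoEdgeRF12 (w : Sym2 (Fin n) → unitInterval) (e₁ e₂ : Sym2 (Fin n)) (A B C : Set (BondConfig (Fin n))) : ℝ :=
  3 * trilin (pin₂ w e₁ e₂ 1 0) (pin₂ w e₁ e₂ 0 1) (pin₂ w e₁ e₂ 0 1) A B C
    + 6 * trilin (pin₂ w e₁ e₂ 1 1) (pin₂ w e₁ e₂ 0 1) (pin₂ w e₁ e₂ 0 0) A B C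

/-- The mixed root fibre of profile `(2,1)`: `3·trilin(P⁰¹,P¹⁰,P¹⁰) + 6·trilin(P⁰⁰,P¹¹,P¹⁰)`. [this work] -/
def twoEdgeRF21 (w : Sym2 (Fin n) → unitInterval) (e₁ e₂ : Sym2 (Fin n)) (A B C : Set (BondConfig (Fin n))) : ℝ :=
  3 * trilin (pin₂ w e₁ e₂ 0 1) (pin₂ w e₁ e₂ 1 0) (pin₂ w e₁ e₂ 1 0) A B C
    + 6 * trilin (pin₂ w e₁ e₂ 0 0) (pin₂ w e₁ e₂ 1 1) (pin₂ w e₁ e₂ 1 0) A B C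

/-- The mixed root fibre of profile `(2,2)`: `3·trilin(P⁰⁰,P¹¹,P¹¹) + 6·trilin(P⁰¹,P¹¹,P¹⁰)`. [this work] -/
def twoEdgeRF22 (w : Sym2 (Fin n) → unitInterval) (e₁ e₂ : Sym2 (Fin n)) (A B C : Set (BondConfig (Fin n))) : ℝ :=
  3 * trilin (pin₂ w e₁ e₂ 0 0) (pin₂ w e₁ e₂ 1 1) (pin₂ w e₁ e₂ 1 1) A B C
    + 6 * trilin (pin₂ w e₁ e₂ 0 1) (pin₂ w e₁ e₂ 1 1) (pin₂ w e₁ e₂ 1 0) A B C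

/-- **A polarised form along one further pair.**  If `w, w'` agree at `e`, with `r = w e`:
`polar₁(P_w, P_{w'}) = (1−r)³·polar₁(P_{w[e↦0]}, P_{w'[e↦0]}) + r(1−r)²·(trilin(P_{w'[e↦1]}, P_{w[e↦0]}, P_{w[e↦0]}) + 2·trilin(P_{w'[e↦0]}, P_{w[e↦1]}, P_{w[e↦0]}))`
`+ r²(1−r)·(2·trilin(P_{w'[e↦1]}, P_{w[e↦1]}, P_{w[e↦0]}) + trilin(P_{w'[e↦0]}, P_{w[e↦1]}, P_{w[e↦1]})) + r³·polar₁(P_{w[e↦1]}, P_{w'[e↦1]})`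
(trilinearity of `polar₁ μ ν = trilin ν μ μ` and the one-pair decomposition of each law). [this work] -/
theorem polar₁_oneBond (w w' : Sym2 (Fin n) → unitInterval) (e : Sym2 (Fin n)) (hw : w' e = w e)
    (A B C : Set (BondConfig (Fin n))) :
    polar₁ (prodBernoulli w) (prodBernoulli w') A B C =
      (1 - (w e : ℝ)) ^ 3 * polar₁ (prodBernoulli (Function.update w e 0)) (prodBernoulli (Function.update w' e 0)) A B C
      + (w e : ℝ) * (1 - (w e : ℝ)) ^ 2 *
          (trilin (prodBernoulli (Function.update w' e 1)) (prodBernoulli (Function.update w e 0))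
              (prodBernoulli (Function.update w e 0)) A B C
            + 2 * trilin (prodBernoulli (Function.update w' e 0)) (prodBernoulli (Function.update w e 1))
              (prodBernoulli (Function.update w e 0)) A B C)
      + (w e : ℝ) ^ 2 * (1 - (w e : ℝ)) *
          (2 * trilin (prodBernoulli (Function.update w' e 1)) (prodBernoulli (Function.update w e 1))
              (prodBernoulli (Function.update w e 0)) A B C
            + trilin (prodBernoulli (Function.update w' e 0)) (prodBernoulli (Function.update w e 1))
              (prodBernoulli (Function.update w e 1)) A B C)
      + (w e : ℝ) ^ 3 * polar₁ (prodBernoulli (Function.update w e 1)) (prodBernoulli (Function.update w' e 1)) A B C := by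
  simp only [polar₁, trilin]
  have h' := fun S => stub_oneBondDecomp_k15 n w' e S
  simp only [hw] at h'
  rw [stub_oneBondDecomp_k15 n w e (A ∩ B ∩ C), stub_oneBondDecomp_k15 n w e A, stub_oneBondDecomp_k15 n w e B,
    stub_oneBondDecomp_k15 n w e C, stub_oneBondDecomp_k15 n w e (B ∩ C), stub_oneBondDecomp_k15 n w e (A ∩ C),
    stub_oneBondDecomp_k15 n w e (A ∩ B), h' (A ∩ B ∩ C), h' A, h' B, h' C, h' (B ∩ C), h' (A ∩ C), h' (A ∩ B)]
  ring

/-- Double pinning decomposition of a probability: for `e₁ ≠ e₂`, `P_w(S) = Σ_{a,b} p^a(1−p)^{1−a} r^b(1−r)^{1−b} P^{ab}(S)` with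
`p = w e₁`, `r = w e₂`. [this work] -/
theorem real_twoBondDecomp (w : Sym2 (Fin n) → unitInterval) {e₁ e₂ : Sym2 (Fin n)} (hne : e₁ ≠ e₂)
    (S : Set (BondConfig (Fin n))) :
    (prodBernoulli w).real S =
      (1 - (w e₁ : ℝ)) * (1 - (w e₂ : ℝ)) * (pin₂ w e₁ e₂ 0 0).real S
      + (1 - (w e₁ : ℝ)) * (w e₂ : ℝ) * (pin₂ w e₁ e₂ 0 1).real S
      + (w e₁ : ℝ) * (1 - (w e₂ : ℝ)) * (pin₂ w e₁ e₂ 1 0).real S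
      + (w e₁ : ℝ) * (w e₂ : ℝ) * (pin₂ w e₁ e₂ 1 1).real S := by
  have h0 := stub_oneBondDecomp_k15 n w e₁ S
  have h00 := stub_oneBondDecomp_k15 n (Function.update w e₁ 0) e₂ S
  have h01 := stub_oneBondDecomp_k15 n (Function.update w e₁ 1) e₂ S
  have hw0 : (Function.update w e₁ (0 : unitInterval)) e₂ = w e₂ := Function.update_of_ne hne.symm _ _
  have hw1 : (Function.update w e₁ (1 : unitInterval)) e₂ = w e₂ := Function.update_of_ne hne.symm _ _
  rw [hw0] at h00
  rw [hw1] at h01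
  simp only [pin₂]
  rw [h0, h00, h01]
  ring

/-- **`E₃` along TWO pairs is a tensor-Bernstein bicubic** in `p = w e₁`, `r = w e₂` (`e₁ ≠ e₂`), for arbitrary events `A, B, C`:
the coefficient of `p^i(1−p)^{3−i} r^j(1−r)^{3−j}` is the root-fibre sum `RF_{ij}` — a corner cubic `E₃(P^{ab})` for `i,j ∈ {0,3}`, three
times a `polar₁` of two pinned laws when exactly one of `i, j` lies in `{1,2}`, and the mixed fibres `twoEdgeRF11 … twoEdgeRF22` otherwise
(three independent copies conditioned on their states at `e₁, e₂`; trilinearity). [this work] -/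
theorem sahiE3_twoBond (w : Sym2 (Fin n) → unitInterval) {e₁ e₂ : Sym2 (Fin n)} (hne : e₁ ≠ e₂)
    (A B C : Set (BondConfig (Fin n))) :
    sahiE3 (prodBernoulli w) A B C =
      (1 - (w e₁ : ℝ)) ^ 3 * (1 - (w e₂ : ℝ)) ^ 3 * sahiE3 (pin₂ w e₁ e₂ 0 0) A B C
      + (1 - (w e₁ : ℝ)) ^ 3 * ((w e₂ : ℝ) * (1 - (w e₂ : ℝ)) ^ 2) *
          (3 * polar₁ (pin₂ w e₁ e₂ 0 0) (pin₂ w e₁ e₂ 0 1) A B C)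
      + (1 - (w e₁ : ℝ)) ^ 3 * ((w e₂ : ℝ) ^ 2 * (1 - (w e₂ : ℝ))) *
          (3 * polar₁ (pin₂ w e₁ e₂ 0 1) (pin₂ w e₁ e₂ 0 0) A B C)
      + (1 - (w e₁ : ℝ)) ^ 3 * (w e₂ : ℝ) ^ 3 * sahiE3 (pin₂ w e₁ e₂ 0 1) A B C
      + ((w e₁ : ℝ) * (1 - (w e₁ : ℝ)) ^ 2) * (1 - (w e₂ : ℝ)) ^ 3 *
          (3 * polar₁ (pin₂ w e₁ e₂ 0 0) (pin₂ w e₁ e₂ 1 0) A B C)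
      + ((w e₁ : ℝ) * (1 - (w e₁ : ℝ)) ^ 2) * ((w e₂ : ℝ) * (1 - (w e₂ : ℝ)) ^ 2) * twoEdgeRF11 w e₁ e₂ A B C
      + ((w e₁ : ℝ) * (1 - (w e₁ : ℝ)) ^ 2) * ((w e₂ : ℝ) ^ 2 * (1 - (w e₂ : ℝ))) * twoEdgeRF12 w e₁ e₂ A B C
      + ((w e₁ : ℝ) * (1 - (w e₁ : ℝ)) ^ 2) * (w e₂ : ℝ) ^ 3 *
          (3 * polar₁ (pin₂ w e₁ e₂ 0 1) (pin₂ w e₁ e₂ 1 1) A B C)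
      + ((w e₁ : ℝ) ^ 2 * (1 - (w e₁ : ℝ))) * (1 - (w e₂ : ℝ)) ^ 3 *
          (3 * polar₁ (pin₂ w e₁ e₂ 1 0) (pin₂ w e₁ e₂ 0 0) A B C)
      + ((w e₁ : ℝ) ^ 2 * (1 - (w e₁ : ℝ))) * ((w e₂ : ℝ) * (1 - (w e₂ : ℝ)) ^ 2) * twoEdgeRF21 w e₁ e₂ A B C
      + ((w e₁ : ℝ) ^ 2 * (1 - (w e₁ : ℝ))) * ((w e₂ : ℝ) ^ 2 * (1 - (w e₂ : ℝ))) * twoEdgeRF22 w e₁ e₂ A B C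
      + ((w e₁ : ℝ) ^ 2 * (1 - (w e₁ : ℝ))) * (w e₂ : ℝ) ^ 3 *
          (3 * polar₁ (pin₂ w e₁ e₂ 1 1) (pin₂ w e₁ e₂ 0 1) A B C)
      + (w e₁ : ℝ) ^ 3 * (1 - (w e₂ : ℝ)) ^ 3 * sahiE3 (pin₂ w e₁ e₂ 1 0) A B C
      + (w e₁ : ℝ) ^ 3 * ((w e₂ : ℝ) * (1 - (w e₂ : ℝ)) ^ 2) *
          (3 * polar₁ (pin₂ w e₁ e₂ 1 0) (pin₂ w e₁ e₂ 1 1) A B C)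
      + (w e₁ : ℝ) ^ 3 * ((w e₂ : ℝ) ^ 2 * (1 - (w e₂ : ℝ))) *
          (3 * polar₁ (pin₂ w e₁ e₂ 1 1) (pin₂ w e₁ e₂ 1 0) A B C)
      + (w e₁ : ℝ) ^ 3 * (w e₂ : ℝ) ^ 3 * sahiE3 (pin₂ w e₁ e₂ 1 1) A B C := by
  have hw0 : (Function.update w e₁ (0 : unitInterval)) e₂ = w e₂ := Function.update_of_ne hne.symm _ _
  have hw1 : (Function.update w e₁ (1 : unitInterval)) e₂ = w e₂ := Function.update_of_ne hne.symm _ _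
  have s0 := sahiE3_oneBond (Function.update w e₁ 0) e₂ A B C
  have s1 := sahiE3_oneBond (Function.update w e₁ 1) e₂ A B C
  have q01 := polar₁_oneBond (Function.update w e₁ 0) (Function.update w e₁ 1) e₂ (by rw [hw0, hw1]) A B C
  have q10 := polar₁_oneBond (Function.update w e₁ 1) (Function.update w e₁ 0) e₂ (by rw [hw0, hw1]) A B C
  rw [hw0] at s0 q01
  rw [hw1] at s1 q10
  rw [sahiE3_oneBond w e₁ A B C, s0, s1, q01, q10]
  simp only [pin₂, twoEdgeRF11, twoEdgeRF12, twoEdgeRF21, twoEdgeRF22]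
  ring

/-- **TWO-EDGE BERNSTEIN SCHEMA.**  If the four corner cubics `E₃(P^{ab})`, the eight one-edge polarised forms of the pinned laws and the
four mixed root fibres `RF₁₁, RF₁₂, RF₂₁, RF₂₂` are all nonnegative, then `E₃(A,B,C) ≥ 0` under `prodBernoulli w` (`e₁ ≠ e₂`, arbitrary
events).  For the increasing star at a root of degree two the first twelve hypotheses are induction hypotheses and root-edge Bernstein (hRZ)
forms of the pinned graphs. [this work] -/
theorem sahiE3_nonneg_of_twoBond (w : Sym2 (Fin n) → unitInterval) {e₁ e₂ : Sym2 (Fin n)} (hne : e₁ ≠ e₂)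
    (A B C : Set (BondConfig (Fin n)))
    (h00 : 0 ≤ sahiE3 (pin₂ w e₁ e₂ 0 0) A B C) (h03 : 0 ≤ sahiE3 (pin₂ w e₁ e₂ 0 1) A B C)
    (h30 : 0 ≤ sahiE3 (pin₂ w e₁ e₂ 1 0) A B C) (h33 : 0 ≤ sahiE3 (pin₂ w e₁ e₂ 1 1) A B C)
    (h01 : 0 ≤ polar₁ (pin₂ w e₁ e₂ 0 0) (pin₂ w e₁ e₂ 0 1) A B C)
    (h02 : 0 ≤ polar₁ (pin₂ w e₁ e₂ 0 1) (pin₂ w e₁ e₂ 0 0) A B C)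
    (h10 : 0 ≤ polar₁ (pin₂ w e₁ e₂ 0 0) (pin₂ w e₁ e₂ 1 0) A B C)
    (h20 : 0 ≤ polar₁ (pin₂ w e₁ e₂ 1 0) (pin₂ w e₁ e₂ 0 0) A B C)
    (h13 : 0 ≤ polar₁ (pin₂ w e₁ e₂ 0 1) (pin₂ w e₁ e₂ 1 1) A B C)
    (h23 : 0 ≤ polar₁ (pin₂ w e₁ e₂ 1 1) (pin₂ w e₁ e₂ 0 1) A B C)
    (h31 : 0 ≤ polar₁ (pin₂ w e₁ e₂ 1 0) (pin₂ w e₁ e₂ 1 1) A B C)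
    (h32 : 0 ≤ polar₁ (pin₂ w e₁ e₂ 1 1) (pin₂ w e₁ e₂ 1 0) A B C)
    (h11 : 0 ≤ twoEdgeRF11 w e₁ e₂ A B C) (h12 : 0 ≤ twoEdgeRF12 w e₁ e₂ A B C)
    (h21 : 0 ≤ twoEdgeRF21 w e₁ e₂ A B C) (h22 : 0 ≤ twoEdgeRF22 w e₁ e₂ A B C) :
    0 ≤ sahiE3 (prodBernoulli w) A B C := by
  rw [sahiE3_twoBond w hne A B C]
  have hp0 : (0 : ℝ) ≤ w e₁ := (w e₁).2.1
  have hp1 : (0 : ℝ) ≤ 1 - (w e₁ : ℝ) := sub_nonneg.2 (w e₁).2.2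
  have hr0 : (0 : ℝ) ≤ w e₂ := (w e₂).2.1
  have hr1 : (0 : ℝ) ≤ 1 - (w e₂ : ℝ) := sub_nonneg.2 (w e₂).2.2
  generalize (w e₁ : ℝ) = p at hp0 hp1 ⊢
  generalize (w e₂ : ℝ) = r at hr0 hr1 ⊢
  generalize sahiE3 (pin₂ w e₁ e₂ 0 0) A B C = x00 at h00 ⊢
  generalize sahiE3 (pin₂ w e₁ e₂ 0 1) A B C = x03 at h03 ⊢
  generalize sahiE3 (pin₂ w e₁ e₂ 1 0) A B C = x30 at h30 ⊢
  generalize sahiE3 (pin₂ w e₁ e₂ 1 1) A B C = x33 at h33 ⊢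
  generalize polar₁ (pin₂ w e₁ e₂ 0 0) (pin₂ w e₁ e₂ 0 1) A B C = x01 at h01 ⊢
  generalize polar₁ (pin₂ w e₁ e₂ 0 1) (pin₂ w e₁ e₂ 0 0) A B C = x02 at h02 ⊢
  generalize polar₁ (pin₂ w e₁ e₂ 0 0) (pin₂ w e₁ e₂ 1 0) A B C = x10 at h10 ⊢
  generalize polar₁ (pin₂ w e₁ e₂ 1 0) (pin₂ w e₁ e₂ 0 0) A B C = x20 at h20 ⊢
  generalize polar₁ (pin₂ w e₁ e₂ 0 1) (pin₂ w e₁ e₂ 1 1) A B C = x13 at h13 ⊢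
  generalize polar₁ (pin₂ w e₁ e₂ 1 1) (pin₂ w e₁ e₂ 0 1) A B C = x23 at h23 ⊢
  generalize polar₁ (pin₂ w e₁ e₂ 1 0) (pin₂ w e₁ e₂ 1 1) A B C = x31 at h31 ⊢
  generalize polar₁ (pin₂ w e₁ e₂ 1 1) (pin₂ w e₁ e₂ 1 0) A B C = x32 at h32 ⊢
  generalize twoEdgeRF11 w e₁ e₂ A B C = x11 at h11 ⊢
  generalize twoEdgeRF12 w e₁ e₂ A B C = x12 at h12 ⊢
  generalize twoEdgeRF21 w e₁ e₂ A B C = x21 at h21 ⊢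
  generalize twoEdgeRF22 w e₁ e₂ A B C = x22 at h22 ⊢
  positivity

end EdgeInduction

end Summit.CriticalPhenomena.PercolationContinuityZ3.Theorems

end
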